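import Summits.KontsevichZagierPeriods.KontsevichZagierPeriods.Theses.FurushoPentagon
import Literature.NumberTheory.Transcendental.KZLogCalculusProofs
import Literature.NumberTheory.Transcendental.SemialgebraicMapsProofs

/-!
# `DoubleShuffleInKZ` (stmt-KontsevichZagierPeriods-14665, route `FurushoPentagon`): dilation calculus at a block

Helper file (`--supports stmt-KontsevichZagierPeriods-14665`), line "rider lever" for the
Kaneko–Yamamoto integral–series family `IS_j(u)`.  The dilation calculus of the
`HoffmanRelationInKZ` line (`stub_dilationCalculus`: Euler homogeneity of the cubical integrand under
the shear `x₀ ↦ λ x₀`) is redone at the FIRST SLOT `q = p_m` OF AN ARBITRARY BLOCK `m`: for the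
cubical integrand `f = ∏_{l<k} T_{p_l}/(1 − T_{p_{l+1}})` (`T_r(x) = x₀ ⋯ x_{r-1}`, block ends
`p₀ = 0 < p₁ < ⋯ < p_k`) and the kernel `K = f · Σ_{l ≥ m} 1/(1 − T_{p_{l+1}})`,

* `b ↦ b · f(x|_{q := b}) = ∏_{l<k} ([l ≥ m] b) S_{p_l} / (1 − ([l ≥ m] b) S_{p_{l+1}})` in the
  `x_q`-free products `S_r = ∏_{i<r, i≠q} x_i` (`update_mul_closedForm`);
* Euler homogeneity `∂_b (b · f(x|_{q := b})) = K(x|_{q := b})` on `(0,1)` (`update_mul_hasDerivAt`),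
  continuity of `b ↦ b f(x|_{q := b})` on `[0,1]`, `K ≥ 0`, `f ≥ 0`;
* (`ℚ`-semialgebraicity of `f` and `K` is in the sibling file `…DilationSlotSemialg.lean`).

Everything is abstract in the block-end sequence `p` (hypotheses `p l ≥ 2` for `l ≥ 1`, `p`
increasing up to `k`), in the style of `HoffmanRelationInKZ.dilationCalculus_of`; the block ends of
an admissible index `w` are `p_l = (w.take l).sum`.

References: M. Kontsevich, D. Zagier, *Periods* (2001), §1.2; M. E. Hoffman, Pacific J. Math. 152
(1992), Thm 5.1; M. Kaneko, S. Yamamoto, Selecta Math. 24 (2018), Thm 4.1.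
-/

noncomputable section

open Set MeasureTheory Function
open Literature.NumberTheory.Transcendental
open Literature.ModelTheory.ExponentialFields (IsSemialgebraic)

namespace Summit.KontsevichZagierPeriods.FurushoPentagon.DoubleShuffleInKZ

section Slot

variable {N : ℕ}

/-! ### Partial products with one coordinate replaced -/

/-- Replacing the coordinate `q` by `b` multiplies a partial product `T_r = x₀⋯x_{r-1}` containing
it (`q < r`) by `b` and leaves the others unchanged: `T_r(x|_{q:=b}) = ([q < r] b) · S_r(x)` with the
`x_q`-free product `S_r = ∏_{i<r, i≠q} x_i`. [folklore] -/
theorem pprod_update (q : Fin N) (T S : ℕ → (Fin N → ℝ) → ℝ)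
    (hT : ∀ r x, T r x = ∏ j : Fin N, if (j : ℕ) < r then x j else 1)
    (hS : ∀ r x, S r x = ∏ j : Fin N, if (j : ℕ) < r ∧ (j : ℕ) ≠ q then x j else 1)
    (r : ℕ) (x : Fin N → ℝ) (b : ℝ) :
    T r (update x q b) = (if (q : ℕ) < r then b else 1) * S r x := by
  rw [hT, hS, ← Finset.mul_prod_erase Finset.univ _ (Finset.mem_univ q),
    ← Finset.mul_prod_erase Finset.univ (fun j : Fin N => if (j : ℕ) < r ∧ (j : ℕ) ≠ q then x j else 1)
      (Finset.mem_univ q)]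
  simp only [update_self, ne_eq, not_true_eq_false, and_false, if_false, one_mul]
  congr 1
  refine Finset.prod_congr rfl fun j hj => ?_
  have hjq : j ≠ q := Finset.ne_of_mem_erase hj
  have hjq' : (j : ℕ) ≠ q := fun h => hjq (Fin.ext h)
  rw [update_of_ne hjq]
  by_cases h : (j : ℕ) < r
  · rw [if_pos h, if_pos ⟨h, hjq'⟩]
  · rw [if_neg h, if_neg (fun h' => h h'.1)]

/-- The `x_q`-free products are unchanged by replacing the coordinate `q`. [folklore] -/
theorem sprod_update (q : Fin N) (S : ℕ → (Fin N → ℝ) → ℝ)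
    (hS : ∀ r x, S r x = ∏ j : Fin N, if (j : ℕ) < r ∧ (j : ℕ) ≠ q then x j else 1)
    (r : ℕ) (x : Fin N → ℝ) (b : ℝ) : S r (update x q b) = S r x := by
  rw [hS, hS]
  refine Finset.prod_congr rfl fun j _ => ?_
  by_cases h : (j : ℕ) < r ∧ (j : ℕ) ≠ q
  · rw [if_pos h, if_pos h, update_of_ne (fun h' => h.2 (congrArg Fin.val h'))]
  · rw [if_neg h, if_neg h]

/-- The `x_q`-free products of a point with coordinates (other than `q`) in `[0,1]` lie in `[0,1]`.
[folklore] -/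
theorem sprod_mem_Icc (q : Fin N) (S : ℕ → (Fin N → ℝ) → ℝ)
    (hS : ∀ r x, S r x = ∏ j : Fin N, if (j : ℕ) < r ∧ (j : ℕ) ≠ q then x j else 1)
    {x : Fin N → ℝ} (hx : ∀ i : Fin N, (i : ℕ) ≠ q → x i ∈ Icc (0:ℝ) 1) (r : ℕ) :
    S r x ∈ Icc (0:ℝ) 1 := by
  rw [hS]
  refine ⟨Finset.prod_nonneg fun j _ => ?_, Finset.prod_le_one (fun j _ => ?_) fun j _ => ?_⟩
  · split_ifs with h
    exacts [(hx j h.2).1, zero_le_one]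
  · split_ifs with h
    exacts [(hx j h.2).1, zero_le_one]
  · split_ifs with h
    exacts [(hx j h.2).2, le_rfl]

/-- A `x_q`-free product `S_r` with `r ≥ 2` of a point with coordinates (other than `q`) in `(0,1)`
is `< 1`: it contains the factor `x₀` or `x₁`. [folklore] -/
theorem sprod_lt_one (hN : 2 ≤ N) (q : Fin N) (S : ℕ → (Fin N → ℝ) → ℝ)
    (hS : ∀ r x, S r x = ∏ j : Fin N, if (j : ℕ) < r ∧ (j : ℕ) ≠ q then x j else 1)
    {x : Fin N → ℝ} (hx : ∀ i : Fin N, (i : ℕ) ≠ q → x i ∈ Ioo (0:ℝ) 1)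
    {r : ℕ} (hr : 2 ≤ r) : S r x < 1 := by
  -- an index `i ∈ {0, 1}`, `i ≠ q`
  obtain ⟨i, hi2, hiq⟩ : ∃ i : Fin N, (i : ℕ) < 2 ∧ (i : ℕ) ≠ q := by
    by_cases hq : (q : ℕ) = 0
    · exact ⟨⟨1, by omega⟩, by simp, by simp [hq]⟩
    · exact ⟨⟨0, by omega⟩, by simp, fun h => hq h.symm⟩
  have hx' : ∀ j : Fin N, (j : ℕ) ≠ q → x j ∈ Icc (0:ℝ) 1 := fun j hj =>
    ⟨(hx j hj).1.le, (hx j hj).2.le⟩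
  rw [hS, ← Finset.mul_prod_erase Finset.univ _ (Finset.mem_univ i), if_pos ⟨by omega, hiq⟩]
  refine mul_lt_one_of_nonneg_of_lt_one_left (hx i hiq).1.le (hx i hiq).2 ?_
  exact Finset.prod_le_one (fun j _ => by split_ifs with h; exacts [(hx' j h.2).1, zero_le_one])
    fun j _ => by split_ifs with h; exacts [(hx' j h.2).2, le_rfl]

/-! ### The closed form of `b · f(x|_{q := b})` -/

variable {k m : ℕ}

/-- Block ends beyond the slot: for an increasing `p` with `p m = q`, `q < p l ↔ m < l` (`l ≤ k`).
[folklore] -/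
theorem slot_lt_iff (p : ℕ → ℕ) (hp : ∀ l l', l < l' → l' ≤ k → p l < p l') (hmk : m < k)
    {l : ℕ} (hl : l ≤ k) : p m < p l ↔ m < l := by
  constructor
  · intro h
    by_contra hle
    rcases (not_lt.mp hle).lt_or_eq with hlt | rfl
    · exact absurd (hp l m hlt hmk.le) (not_lt.mpr h.le)
    · exact lt_irrefl _ h
  · intro h
    exact hp m l h hl

/-- **Closed form.** For the cubical integrand `f = ∏_{l<k} T_{p_l}/(1 − T_{p_{l+1}})` and the
first slot `q = p_m` of block `m < k`:
`b · f(x|_{q := b}) = ∏_{l<k} ([m ≤ l] b) S_{p_l}(x) / (1 − ([m ≤ l] b) S_{p_{l+1}}(x))`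
(the blocks after `m` are scaled in numerator and denominator, the extra `b` is absorbed by the
numerator of block `m`, whose own `T_{p_m} = T_q` does not contain `x_q`). [folklore] -/
theorem update_mul_closedForm (q : Fin N) (T S : ℕ → (Fin N → ℝ) → ℝ)
    (hT : ∀ r x, T r x = ∏ j : Fin N, if (j : ℕ) < r then x j else 1)
    (hS : ∀ r x, S r x = ∏ j : Fin N, if (j : ℕ) < r ∧ (j : ℕ) ≠ q then x j else 1)
    (p : ℕ → ℕ) (hp : ∀ l l', l < l' → l' ≤ k → p l < p l') (hmk : m < k)
    (hpm : p m = q) (f : (Fin N → ℝ) → ℝ)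
    (hf : ∀ x, f x = ∏ l : Fin k, T (p l) x / (1 - T (p (l + 1)) x)) (x : Fin N → ℝ) (b : ℝ) :
    b * f (update x q b) = ∏ l : Fin k, (if m ≤ (l : ℕ) then b else 1) * S (p l) x /
      (1 - (if m ≤ (l : ℕ) then b else 1) * S (p (l + 1)) x) := by
  have hnum : ∀ l : Fin k, T (p l) (update x q b) = (if m < (l : ℕ) then b else 1) * S (p l) x := by
    intro l
    rw [pprod_update q T S hT hS, ← hpm]
    have hiff := slot_lt_iff p hp hmk l.2.le
    by_cases h : m < (l : ℕ)
    · rw [if_pos (hiff.mpr h), if_pos h]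
    · rw [if_neg (fun h' => h (hiff.mp h')), if_neg h]
  have hden : ∀ l : Fin k, T (p (l + 1)) (update x q b) =
      (if m ≤ (l : ℕ) then b else 1) * S (p (l + 1)) x := by
    intro l
    rw [pprod_update q T S hT hS, ← hpm]
    have hiff := slot_lt_iff p hp hmk (Nat.succ_le_of_lt l.2)
    by_cases h : m ≤ (l : ℕ)
    · rw [if_pos (hiff.mpr (Nat.lt_succ_of_le h)), if_pos h]
    · rw [if_neg (fun h' => h (Nat.lt_succ_iff.mp (hiff.mp h'))), if_neg h]
  simp only [hf, hnum, hden, Finset.prod_div_distrib]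
  rw [← mul_div_assoc]
  congr 1
  -- absorb `b` into the factor `l = m`
  have hm : (⟨m, hmk⟩ : Fin k) ∈ Finset.univ := Finset.mem_univ _
  rw [← Finset.mul_prod_erase _ _ hm, ← Finset.mul_prod_erase _ _ hm]
  simp only [lt_irrefl, if_false, one_mul, le_refl, if_true]
  rw [← mul_assoc]
  congr 1
  refine Finset.prod_congr rfl fun l hl => ?_
  have hne : (l : ℕ) ≠ m := fun h => Finset.ne_of_mem_erase hl (Fin.ext h)
  rcases Nat.lt_or_gt_of_ne hne with h | h
  · rw [if_neg (not_lt.mpr h.le), if_neg (not_le.mpr h)]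
  · rw [if_pos h, if_pos h.le]

/-! ### Denominators, Euler homogeneity, continuity, sign -/

/-- On `{x | x_i ∈ (0,1) (i ≠ q)}` the scaled denominators are positive:
`0 < 1 − c · S_{p_l}(x)` for `l ≥ 1`, `0 ≤ c ≤ 1` (`S_{p_l} < 1` as `p_l ≥ 2`). [folklore] -/
theorem one_sub_mul_sprod_pos (hN : 2 ≤ N) (q : Fin N) (S : ℕ → (Fin N → ℝ) → ℝ)
    (hS : ∀ r x, S r x = ∏ j : Fin N, if (j : ℕ) < r ∧ (j : ℕ) ≠ q then x j else 1)
    (p : ℕ → ℕ) (hp2 : ∀ l, 1 ≤ l → 2 ≤ p l) {x : Fin N → ℝ}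
    (hx : ∀ i : Fin N, (i : ℕ) ≠ q → x i ∈ Ioo (0:ℝ) 1) {c : ℝ} (hc1 : c ≤ 1)
    {l : ℕ} (hl : 1 ≤ l) : 0 < 1 - c * S (p l) x := by
  have h1 : S (p l) x < 1 := sprod_lt_one hN q S hS hx (hp2 l hl)
  have h0 : 0 ≤ S (p l) x :=
    (sprod_mem_Icc q S hS (fun i hi => ⟨(hx i hi).1.le, (hx i hi).2.le⟩) (p l)).1
  nlinarith [mul_le_of_le_one_left h0 hc1]

/-- **Euler homogeneity at the slot `q = p_m`.** For `x` with `x_i ∈ (0,1)` (`i ≠ q`) and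
`b ∈ (0,1)`: `∂_b (b · f(x|_{q := b})) = K(x|_{q := b})` with
`K = f · Σ_{m ≤ l < k} 1/(1 − T_{p_{l+1}})` (product rule on the closed form: the factors `l < m`
are constant in `b`, each factor `b S_{p_l}/(1 − b S_{p_{l+1}})`, `l ≥ m`, has logarithmic
derivative `1/(b (1 − b S_{p_{l+1}}))`). [folklore] -/
theorem update_mul_hasDerivAt (hN : 2 ≤ N) (q : Fin N) (T S : ℕ → (Fin N → ℝ) → ℝ)
    (hT : ∀ r x, T r x = ∏ j : Fin N, if (j : ℕ) < r then x j else 1)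
    (hS : ∀ r x, S r x = ∏ j : Fin N, if (j : ℕ) < r ∧ (j : ℕ) ≠ q then x j else 1)
    (p : ℕ → ℕ) (hp : ∀ l l', l < l' → l' ≤ k → p l < p l') (hp2 : ∀ l, 1 ≤ l → 2 ≤ p l)
    (hmk : m < k) (hpm : p m = q) (f K : (Fin N → ℝ) → ℝ)
    (hf : ∀ x, f x = ∏ l : Fin k, T (p l) x / (1 - T (p (l + 1)) x))
    (hK : ∀ x, K x = f x * ∑ l : Fin k, if m ≤ (l : ℕ) then 1 / (1 - T (p (l + 1)) x) else 0)
    {x : Fin N → ℝ} (hx : ∀ i : Fin N, (i : ℕ) ≠ q → x i ∈ Ioo (0:ℝ) 1) {b : ℝ}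
    (hb : b ∈ Ioo (0:ℝ) 1) :
    HasDerivAt (fun b : ℝ => b * f (update x q b)) (K (update x q b)) b := by
  -- abbreviations
  set a : Fin k → ℝ := fun l => S (p l) x with ha
  set d : Fin k → ℝ := fun l => S (p (l + 1)) x with hd
  have hclosed : ∀ y : ℝ, y * f (update x q y) =
      ∏ l : Fin k, (if m ≤ (l : ℕ) then y else 1) * a l / (1 - (if m ≤ (l : ℕ) then y else 1) * d l) :=
    fun y => update_mul_closedForm q T S hT hS p hp hmk hpm f hf x y
  have hdpos : ∀ (l : Fin k) {c : ℝ}, c ≤ 1 → 0 < 1 - c * d l := fun l c hc1 =>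
    one_sub_mul_sprod_pos hN q S hS p hp2 hx hc1 (Nat.succ_pos l)
  have hapos : ∀ l : Fin k, 0 < a l := by
    intro l
    show 0 < S (p l) x
    rw [hS]
    exact Finset.prod_pos fun j _ => by
      split_ifs with h
      exacts [(hx j h.2).1, one_pos]
  -- derivative of each factor
  have hu : ∀ l ∈ (Finset.univ : Finset (Fin k)),
      HasDerivAt (fun y : ℝ => (if m ≤ (l : ℕ) then y else 1) * a l /
          (1 - (if m ≤ (l : ℕ) then y else 1) * d l))
        (if m ≤ (l : ℕ) then (a l * (1 - b * d l) - b * a l * -d l) / (1 - b * d l) ^ 2 else 0) b := by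
    intro l _
    by_cases hl : m ≤ (l : ℕ)
    · simp only [if_pos hl]
      exact (hasDerivAt_mul_const _).div ((hasDerivAt_mul_const _).const_sub 1)
        (hdpos l hb.2.le).ne'
    · simp only [if_neg hl, one_mul]
      exact hasDerivAt_const _ _
  have hg := HasDerivAt.fun_finsetProd hu
  have hfun : (fun y : ℝ => y * f (update x q y)) = fun y => ∏ l : Fin k,
      (if m ≤ (l : ℕ) then y else 1) * a l / (1 - (if m ≤ (l : ℕ) then y else 1) * d l) :=
    funext hclosed
  rw [hfun]
  refine hg.congr_deriv ?_
  -- identify the kernel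
  have hfval : f (update x q b) =
      (∏ l : Fin k, (if m ≤ (l : ℕ) then b else 1) * a l / (1 - (if m ≤ (l : ℕ) then b else 1) * d l)) / b :=
    eq_div_of_mul_eq hb.1.ne' (by rw [mul_comm]; exact hclosed b)
  have hTd : ∀ l : Fin k, T (p (l + 1)) (update x q b) = (if m ≤ (l : ℕ) then b else 1) * d l := by
    intro l
    rw [pprod_update q T S hT hS, ← hpm]
    have hiff := slot_lt_iff p hp hmk (Nat.succ_le_of_lt l.2)
    by_cases h : m ≤ (l : ℕ)
    · rw [if_pos (hiff.mpr (Nat.lt_succ_of_le h)), if_pos h]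
    · rw [if_neg (fun h' => h (Nat.lt_succ_iff.mp (hiff.mp h'))), if_neg h]
  rw [hK, hfval]
  simp only [hTd, smul_eq_mul]
  rw [Finset.mul_sum]
  refine Finset.sum_congr rfl fun l _ => ?_
  by_cases hl : m ≤ (l : ℕ)
  · simp only [if_pos hl]
    have hsplit := Finset.mul_prod_erase Finset.univ
      (fun j : Fin k => (if m ≤ (j : ℕ) then b else 1) * a j /
        (1 - (if m ≤ (j : ℕ) then b else 1) * d j)) (Finset.mem_univ l)
    rw [← hsplit]
    simp only [if_pos hl]
    have hb0 : b ≠ 0 := hb.1.ne'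
    have hDl : 1 - b * d l ≠ 0 := (hdpos l hb.2.le).ne'
    have hal : a l ≠ 0 := (hapos l).ne'
    field_simp
    ring
  · simp only [if_neg hl, mul_zero]

/-- Continuity of `b ↦ b · f(x|_{q := b})` on `[0,1]` for `x` with `x_i ∈ (0,1)` (`i ≠ q`)
(closed form: a finite product of quotients with positive denominators). [folklore] -/
theorem update_mul_continuousOn (hN : 2 ≤ N) (q : Fin N) (T S : ℕ → (Fin N → ℝ) → ℝ)
    (hT : ∀ r x, T r x = ∏ j : Fin N, if (j : ℕ) < r then x j else 1)
    (hS : ∀ r x, S r x = ∏ j : Fin N, if (j : ℕ) < r ∧ (j : ℕ) ≠ q then x j else 1)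
    (p : ℕ → ℕ) (hp : ∀ l l', l < l' → l' ≤ k → p l < p l') (hp2 : ∀ l, 1 ≤ l → 2 ≤ p l)
    (hmk : m < k) (hpm : p m = q) (f : (Fin N → ℝ) → ℝ)
    (hf : ∀ x, f x = ∏ l : Fin k, T (p l) x / (1 - T (p (l + 1)) x))
    {x : Fin N → ℝ} (hx : ∀ i : Fin N, (i : ℕ) ≠ q → x i ∈ Ioo (0:ℝ) 1) :
    ContinuousOn (fun b : ℝ => b * f (update x q b)) (Icc 0 1) := by
  have hfun : (fun y : ℝ => y * f (update x q y)) = fun y => ∏ l : Fin k,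
      (if m ≤ (l : ℕ) then y else 1) * S (p l) x /
        (1 - (if m ≤ (l : ℕ) then y else 1) * S (p (l + 1)) x) :=
    funext fun y => update_mul_closedForm q T S hT hS p hp hmk hpm f hf x y
  rw [hfun]
  refine continuousOn_finsetProd _ fun l _ => ContinuousOn.div ?_ ?_ fun c hc => ?_
  · refine Continuous.continuousOn ?_
    split_ifs <;> fun_prop
  · refine Continuous.continuousOn ?_
    split_ifs <;> fun_prop
  · split_ifs with h
    · exact (one_sub_mul_sprod_pos hN q S hS p hp2 hx hc.2 (Nat.succ_pos l)).ne'
    · have h := one_sub_mul_sprod_pos hN q S hS p hp2 hx le_rfl (Nat.succ_pos l)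
      exact h.ne'

/-- Sign of the integrand and the kernel at a replaced point: for `x_i ∈ (0,1)` (`i ≠ q`) and
`b ∈ [0,1]`, `0 ≤ f(x|_{q := b})` and `0 ≤ K(x|_{q := b})`. [folklore] -/
theorem update_nonneg (hN : 2 ≤ N) (q : Fin N) (T S : ℕ → (Fin N → ℝ) → ℝ)
    (hT : ∀ r x, T r x = ∏ j : Fin N, if (j : ℕ) < r then x j else 1)
    (hS : ∀ r x, S r x = ∏ j : Fin N, if (j : ℕ) < r ∧ (j : ℕ) ≠ q then x j else 1)
    (p : ℕ → ℕ) (hp2 : ∀ l, 1 ≤ l → 2 ≤ p l) (f K : (Fin N → ℝ) → ℝ)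
    (hf : ∀ x, f x = ∏ l : Fin k, T (p l) x / (1 - T (p (l + 1)) x))
    (hK : ∀ x, K x = f x * ∑ l : Fin k, if m ≤ (l : ℕ) then 1 / (1 - T (p (l + 1)) x) else 0)
    {x : Fin N → ℝ} (hx : ∀ i : Fin N, (i : ℕ) ≠ q → x i ∈ Ioo (0:ℝ) 1) {b : ℝ}
    (hb : b ∈ Icc (0:ℝ) 1) :
    0 ≤ f (update x q b) ∧ 0 ≤ K (update x q b) := by
  have hden : ∀ l : ℕ, 1 ≤ l → 0 < 1 - T (p l) (update x q b) := by
    intro l hl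
    rw [pprod_update q T S hT hS]
    split_ifs
    · exact one_sub_mul_sprod_pos hN q S hS p hp2 hx hb.2 hl
    · have h := one_sub_mul_sprod_pos hN q S hS p hp2 hx le_rfl hl
      exact h
  have hnum : ∀ r : ℕ, 0 ≤ T r (update x q b) := by
    intro r
    rw [hT]
    refine Finset.prod_nonneg fun j _ => ?_
    split_ifs
    · by_cases hj : j = q
      · subst hj; rw [update_self]; exact hb.1
      · rw [update_of_ne hj]; exact (hx j (fun h => hj (Fin.ext h))).1.le
    · exact zero_le_one
  have hf0 : 0 ≤ f (update x q b) := by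
    rw [hf]
    exact Finset.prod_nonneg fun l _ => div_nonneg (hnum _) (hden _ (Nat.succ_pos l)).le
  refine ⟨hf0, ?_⟩
  rw [hK]
  refine mul_nonneg hf0 (Finset.sum_nonneg fun l _ => ?_)
  split_ifs
  · exact div_nonneg zero_le_one (hden _ (Nat.succ_pos l)).le
  · exact le_rfl

end Slot

end Summit.KontsevichZagierPeriods.FurushoPentagon.DoubleShuffleInKZ
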